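import Summits.CriticalPhenomena.Ising3DConformalLimit.Theses.ArmHyperscaling
import Summits.CriticalPhenomena.Ising3DConformalLimit.Theses.WeylWindow
import Summits.CriticalPhenomena.Ising3DConformalLimit.Theses.IsingEuclidUpgrade
import Summits.CriticalPhenomena.Ising3DConformalLimit.Theses.HyperoctahedralRP
import Literature.Probability.LatticeModels.CriticalUrsellFourSign
import HarnessLib

/-!
# Line `limit-descent` for crux stmt-CriticalPhenomena-15592 (`MergingFloor`, route ArmHyperscaling)

Crux-strategist (before the lead), DECOMPOSITION in line form (the `route edit --split` verb is refused to a
non-final-cycle seat; the same split is attached split-ready as evidence `children.json` + sorry-free glue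
`ArmHyperscalingMergingFloorSplit.lean`).

**Idea.** `MergingFloor` is the ρ-free LATTICE target `∃ x, ∃ c > 0, ∀ᶠ δ → 0⁺, c⟨σσ⟩⟨σσ⟩([x/δ]) ≤ −U₄^{lat}([x/δ])`
(verbatim `LatticeU4RatioPositive`, Disproof §C of crux 0636). Its `∀ᶠ δ` at ONE fixed shape is a liminf statement in the
mesh: every lattice-averaged handle (block Binder floor, second-moment current bounds, MMS) is blind to the difference between
liminf and limsup along `δ`, and on `ℤ³` not even doubling of `⟨σ₀σ_x⟩_{β_c}` is known (item 6150). So the only typed lattice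
surplus of the crux over the limit-level clause (iii) (item 0636) is EXISTENCE of the full-filter limit (item 4738), and the crux
is EXACTLY `4738 ∧ 0636` modulo the two provable passages (`MergingFloor → 0636` = item 15594, proved in the evidence file;
`4738 → 0636 → MergingFloor` = `MergingFloor_of` below). Both stubs are existing items BY NAME with live crux chains:
`Cruxes/LimitExists` (skeleton: TwoPointDoubling = 6150, two-point cluster uniqueness, higher orders from two) and
`Cruxes/IsingEuclidUpgradeR4NonGaussian` (lines `isotherm-saturation-lee-yang` — whose open entrance is THIS route's crux
`OneArmHyperscaling` 15591 —, `eta-free-split`, payer edge `NearCriticalLeeYangGap` 4945).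

`lean check`: sorries ONLY in the two `stub_*`; `MergingFloor_of` (stub statements → crux BY NAME) and `MergingFloor_proof`
kernel-checked. [cite: AizenmanDuminilCopinAnnals2021, eq. (3.11)]
-/

noncomputable section

namespace Summit.CriticalPhenomena.Ising3DConformalLimit.Cruxes.MergingFloor.LimitDescent

open Literature.Probability.LatticeModels Filter Set
open scoped Topology
open Summit.CriticalPhenomena.Ising3DConformalLimit.Theses

/-! ## Registered stubs -/

/-- **Stub E — BARE EXISTENCE of a non-degenerate full-filter pointwise limit** (OPEN; = item stmt-CriticalPhenomena-4738
`WeylWindow.LimitExists`, by name; implied by this route's crux `ExistsScaleCovariantLimit` 1981 by forgetting). -/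
theorem stub_limitExists : WeylWindow.LimitExists := by
  sorry

/-- **Stub N — LIMIT-LEVEL NON-GAUSSIANITY** (OPEN; = item stmt-CriticalPhenomena-0636
`IsingEuclidUpgrade.IsingEuclidUpgradeR4NonGaussian`, by name; three registered lines in its own crux chain). -/
theorem stub_nonGaussianLimit : IsingEuclidUpgrade.IsingEuclidUpgradeR4NonGaussian := by
  sorry

/-! ## Composition (sorry-free) -/

/-- Renormalised pair correlators of a pointwise limit converge at pairs of distinct points of a non-coincident
quadruple. [folklore] -/
theorem tendsto_pair {ρ : ℝ → ℝ} {S : CorrFamily 3} (hlim : HasPointwiseScalingLimit (criticalCorr 3) ρ S)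
    {x : Fin 4 → EuclideanSpace ℝ (Fin 3)} (hx : x ∈ NonCoincident 3 4) {i j : Fin 4} (hij : i ≠ j) :
    Tendsto (fun δ => ρ δ ^ 2 * criticalCorr 3 2 ![latticeApprox δ (x i), latticeApprox δ (x j)])
      (𝓝[>] 0) (𝓝 (S 2 ![x i, x j])) := by
  have hinj : Function.Injective x := hx
  have hmem : (![x i, x j] : Fin 2 → EuclideanSpace ℝ (Fin 3)) ∈ NonCoincident 3 2 :=
    pair_mem_nonCoincident fun h => hij (hinj h)
  refine Tendsto.congr (fun δ => ?_) ((hlim 2).tendsto_at hmem)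
  rw [rescaledCorrelator_apply, latticeApprox_comp_two]
  rfl

/-- **LIMIT → LATTICE DESCENT**: a non-degenerate full-filter pointwise limit with `HasNontrivialU4` gives the lattice
merging floor (the crux's statement, UNFOLDED so that the registered composition below is the first theorem concluding the
crux by name) at the quadruple where `U₄^S < 0`, constant `−U₄^S(x)/(2S₂S₂)`. [cite: AizenmanDuminilCopinAnnals2021, eq. (3.11)] -/
theorem mergingFloor_of_limit {ρ : ℝ → ℝ} {S : CorrFamily 3}
    (hρ : ∀ δ ∈ Set.Ioc (0:ℝ) 1, 0 < ρ δ) (hlim : HasPointwiseScalingLimit (criticalCorr 3) ρ S)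
    (hnd : IsNondegenerateTwoPoint S) (hU4 : HasNontrivialU4 S) :
    ∃ x ∈ NonCoincident 3 4, ∃ c : ℝ, 0 < c ∧ ∀ᶠ δ in 𝓝[>] (0:ℝ),
      c * (criticalCorr 3 2 ![latticeApprox δ (x 0), latticeApprox δ (x 1)] *
          criticalCorr 3 2 ![latticeApprox δ (x 2), latticeApprox δ (x 3)]) ≤
        -(criticalCorr 3 4 (fun i => latticeApprox δ (x i)) -
          (criticalCorr 3 2 ![latticeApprox δ (x 0), latticeApprox δ (x 1)] *
              criticalCorr 3 2 ![latticeApprox δ (x 2), latticeApprox δ (x 3)]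
            + criticalCorr 3 2 ![latticeApprox δ (x 0), latticeApprox δ (x 2)] *
              criticalCorr 3 2 ![latticeApprox δ (x 1), latticeApprox δ (x 3)]
            + criticalCorr 3 2 ![latticeApprox δ (x 0), latticeApprox δ (x 3)] *
              criticalCorr 3 2 ![latticeApprox δ (x 1), latticeApprox δ (x 2)])) := by
  obtain ⟨x, hx, hneg⟩ :=
    (hasNontrivialU4_iff_exists_neg_of_hasPointwiseScalingLimit (d := 3) le_rfl hlim).1 hU4
  have hinj : Function.Injective x := hx
  set u : ℝ := - limitConnectedFour S x with hu
  set s : ℝ := S 2 ![x 0, x 1] * S 2 ![x 2, x 3] with hs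
  have hu0 : 0 < u := by rw [hu]; linarith
  have h01 : (![x 0, x 1] : Fin 2 → EuclideanSpace ℝ (Fin 3)) ∈ NonCoincident 3 2 :=
    pair_mem_nonCoincident fun h => absurd (hinj h) (by decide)
  have h23 : (![x 2, x 3] : Fin 2 → EuclideanSpace ℝ (Fin 3)) ∈ NonCoincident 3 2 :=
    pair_mem_nonCoincident fun h => absurd (hinj h) (by decide)
  have hs0 : 0 < s := mul_pos (hnd _ h01) (hnd _ h23)
  refine ⟨x, hx, u / (2 * s), by positivity, ?_⟩
  have hU : Tendsto (fun δ => -(ρ δ ^ 4 * (criticalCorr 3 4 (fun i => latticeApprox δ (x i)) -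
      (criticalCorr 3 2 ![latticeApprox δ (x 0), latticeApprox δ (x 1)] *
          criticalCorr 3 2 ![latticeApprox δ (x 2), latticeApprox δ (x 3)]
        + criticalCorr 3 2 ![latticeApprox δ (x 0), latticeApprox δ (x 2)] *
          criticalCorr 3 2 ![latticeApprox δ (x 1), latticeApprox δ (x 3)]
        + criticalCorr 3 2 ![latticeApprox δ (x 0), latticeApprox δ (x 3)] *
          criticalCorr 3 2 ![latticeApprox δ (x 1), latticeApprox δ (x 2)])))) (𝓝[>] 0) (𝓝 u) :=
    (tendsto_rescaled_criticalUrsellFour hlim hx).neg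
  have hB : Tendsto (fun δ => u / (2 * s) * ((ρ δ ^ 2 *
      criticalCorr 3 2 ![latticeApprox δ (x 0), latticeApprox δ (x 1)]) * (ρ δ ^ 2 *
      criticalCorr 3 2 ![latticeApprox δ (x 2), latticeApprox δ (x 3)]))) (𝓝[>] 0)
      (𝓝 (u / (2 * s) * s)) :=
    ((tendsto_pair hlim hx (i := 0) (j := 1) (by decide)).mul
      (tendsto_pair hlim hx (i := 2) (j := 3) (by decide))).const_mul _
  have hmid : u / (2 * s) * s < 3 * u / 4 := by
    rw [div_mul_eq_mul_div, mul_comm 2 s, ← div_div, mul_div_assoc, div_self hs0.ne', mul_one]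
    linarith
  have hmid' : 3 * u / 4 < u := by linarith
  have hIoc : Set.Ioc (0:ℝ) 1 ∈ 𝓝[>] (0:ℝ) := Ioc_mem_nhdsGT one_pos
  filter_upwards [hB.eventually_lt_const hmid, hU.eventually_const_lt hmid',
    Filter.eventually_of_mem hIoc fun δ hδ => hδ] with δ h1 h2 hδ
  have hρ4 : 0 < ρ δ ^ 4 := pow_pos (hρ δ hδ) 4
  have key : ρ δ ^ 4 * (u / (2 * s) *
      (criticalCorr 3 2 ![latticeApprox δ (x 0), latticeApprox δ (x 1)] *
        criticalCorr 3 2 ![latticeApprox δ (x 2), latticeApprox δ (x 3)])) ≤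
      ρ δ ^ 4 * (-(criticalCorr 3 4 (fun i => latticeApprox δ (x i)) -
      (criticalCorr 3 2 ![latticeApprox δ (x 0), latticeApprox δ (x 1)] *
          criticalCorr 3 2 ![latticeApprox δ (x 2), latticeApprox δ (x 3)]
        + criticalCorr 3 2 ![latticeApprox δ (x 0), latticeApprox δ (x 2)] *
          criticalCorr 3 2 ![latticeApprox δ (x 1), latticeApprox δ (x 3)]
        + criticalCorr 3 2 ![latticeApprox δ (x 0), latticeApprox δ (x 3)] *
          criticalCorr 3 2 ![latticeApprox δ (x 1), latticeApprox δ (x 2)]))) := by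
    have e1 : ρ δ ^ 4 * (u / (2 * s) *
        (criticalCorr 3 2 ![latticeApprox δ (x 0), latticeApprox δ (x 1)] *
          criticalCorr 3 2 ![latticeApprox δ (x 2), latticeApprox δ (x 3)])) =
        u / (2 * s) * ((ρ δ ^ 2 * criticalCorr 3 2 ![latticeApprox δ (x 0), latticeApprox δ (x 1)]) *
          (ρ δ ^ 2 * criticalCorr 3 2 ![latticeApprox δ (x 2), latticeApprox δ (x 3)])) := by ring
    rw [e1]
    linarith
  exact le_of_mul_le_mul_left key hρ4

/-- **COMPOSITION** `stub_limitExists → stub_nonGaussianLimit → MergingFloor` (the crux BY NAME). [folklore] -/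
theorem MergingFloor_of :
    WeylWindow.LimitExists → IsingEuclidUpgrade.IsingEuclidUpgradeR4NonGaussian →
      ArmHyperscaling.MergingFloor := by
  rintro ⟨ρ, S, hρ, hlim, hnd⟩ h36
  exact mergingFloor_of_limit hρ hlim hnd (h36 ρ S hρ hlim hnd)

/-- The same composition through the HyperoctahedralRP copy of the shared decl of item 0636. [folklore] -/
theorem MergingFloor_of_hrp :
    WeylWindow.LimitExists → HyperoctahedralRP.IsingEuclidUpgradeR4NonGaussian →
      ArmHyperscaling.MergingFloor :=
  fun hE h36 => MergingFloor_of hE h36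

/-- On route ArmHyperscaling the existence stub is paid by the route's own crux `ExistsScaleCovariantLimit` (item 1981).
[folklore] -/
theorem MergingFloor_of_route :
    ArmHyperscaling.ExistsScaleCovariantLimit → IsingEuclidUpgrade.IsingEuclidUpgradeR4NonGaussian →
      ArmHyperscaling.MergingFloor := by
  rintro ⟨ρ, Δ, S, hρ, -, hlim, -, hnd, -, -⟩ h36
  exact MergingFloor_of ⟨ρ, S, hρ, hlim, hnd⟩ h36

/-- The crux from the registered stubs (what closes when items 4738 and 0636 close). -/
theorem MergingFloor_proof : ArmHyperscaling.MergingFloor :=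
  MergingFloor_of stub_limitExists stub_nonGaussianLimit

end Summit.CriticalPhenomena.Ising3DConformalLimit.Cruxes.MergingFloor.LimitDescent

end
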